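import Summits.QuantumFields.YangMills.Theorems.BalabanUVNodesN21GappedTopReading13CoPHSignFree
import Summits.QuantumFields.YangMills.Theorems.BalabanUVNodesN21TwoRunDeviceOfBgCloseness

/-!
# N21 (NE7c) · END-TO-END AT THE GAPPED READING: N21's DECL shape `ShellWeightBound` at dag-n21-d's `crGap₁₃VAt ∕ crGap₁₃V` WITH THE DIALS PRODUCED from ONE relative two-run
# closeness letter `δ` (summable, `≤ 1/16`), together with the consumer's collar-compatibility rows and the selected-depth collar rows — letters `ρ, n` no longer free

Track A of `YM-PLAN.md` (cell `pub-ymgap`), node **N21** (NE7c, NOT PRINTED); WIDTH SEAT `pub-ymgap-dag-n21-w2` (gen 3), file 6.  THEOREMS ONLY: 0 `def`, 0 `sorry`; COUNT-NEUTRAL;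
`--kind proof --supports stmt-QuantumFields-27366 --as helper` (K3⁸ `SpineGivenEndpointR13SepCoPHV`).  Imports dag-n21-d's U8b `…GappedTopReading13CoPHSignFree` (p626047 ✓:
`shellWeightBound_crGap₁₃VAt'`, `keyedShellWeight_shape_crGap₁₃V_of_rows'`) and this seat's file 3 `…TwoRunDeviceOfBgCloseness` (p625475 ✓; → file 2 `exists_widthDepthLetters_of_summable`,
`collar_rows_at_selGapDepth_A∕_B`).  No Theses import; restates nothing.

WHY.  dag-n21-d's (M1)-FREE face `shellWeightBound_crGap₁₃VAt'` reads a width letter `ρ : WidthLetter₁₃CoPH N` and a depth letter `n : DepthLetter₁₃CoPH N` as FREE data under the rows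
`0 ≤ ρ ≤ 1`, `Σ 1/(n+1) < ∞`; the consumer's junction (files 1, 3, 5) needs the SAME letters to clear the two-run closeness at the selected collar.  File 2 produces both from ONE
closeness letter.  THIS FILE is the one-application knit: given `δ : WidthLetter₁₃CoPH N` (N16's relative two-run closeness of the tested cube statistics at the top (2.17)∕(3.2) family,
per tuple and comparison index; DISPLAYED) with `0 ≤ δ ≤ 1/16` and `Σ_K δ_K < ∞` at every tuple, THERE ARE letters `ρ, n` such that (i) N21's `ShellWeightBound` holds at
`crGap₁₃VAt N K₀ jcut ρ n` on the live-selector line under (H-ζ) (U8b BY NAME), (ii) `2δ ≤ ρ`, `(1−ρ)^{n+2} ≥ 1/2`, `δ ≤ (1−ρ)^i ρ` for `i ≤ n+2` at every tuple and `K`, hence (iii) at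
the selected depth the collar letters of `gapShellA₁₃ ∕ gapShellB₁₃` clear `ε·δ_K` on both sides and lie in `[ε/2, ε]` whenever `0 ≤ ε` (file 3 §4).

WHAT IS PROVED ([bookkeeping] BY NAME).
* ★★★ `exists_letters_shellWeightBound_crGap₁₃VAt_of_closeness` — (i) ∧ (ii) for every offset `K₀` and persistence policy `jcut`.
* ★★ `exists_letters_keyedShellWeight_shape_crGap₁₃V_of_closeness` — the K3 stub-2 conjunct's ∀-shape at `crGap₁₃V` (U8b `keyedShellWeight_shape_crGap₁₃V_of_rows'`) with the
  dial rows DISCHARGED by the produced letters, ∧ (ii).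
* ★ `collar_rows_at_selGapDepth_of_compat` — (ii) at one `(tuple, K)` + `0 ≤ ε` ⇒ (iii) for both runs (file 3 §4 restated on this import line for the consumer's convenience).

HONEST FRAMING.  The closeness letter `δ` is a HYPOTHESIS (N16's output shape, NOT PRINTED), inhabited for no family here; the live-selector pin `hsel` and (H-ζ) stay rows; `jcut`,
`K₀` displayed; nothing of Bałaban's asserted; NE7c at print's fixed thresholds NOT PRINTED ∕ NOT proved; **N21 NOT discharged**; K3⁷∕K3⁸ NOT claimed (no `PinnedAtLive` names
`crGap₁₃V` today — plan's decision); counts UNMOVED (typed 28∕28 · discharged 5∕27); never a count claim.  One finite four-torus programme at fixed `ε` — NOT ℝ⁴, NOT OS, NOT a mass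
gap, NOT the Clay problem.  No decl below carries a cite tag.
-/

namespace Summit.QuantumFields.YangMills.Theorems.N21GappedReadingShellFaceOfCloseness

open Literature.MathematicalPhysics.QuantumFieldTheory.Balaban1983to89
open Literature.MathematicalPhysics.QuantumFieldTheory.Balaban1983to89.T4Continuum
open Literature.MathematicalPhysics.QuantumFieldTheory.Balaban1983to89.Node00
open T4IndicatorShell (ShellWeightBound)
open YMDAG.UVSplit (histA₁₃ histB₁₃)
open Summit.QuantumFields.YangMills.Theorems.N21ShellSplitOfRecord13CoPH
  (WidthLetter₁₃CoPH DepthLetter₁₃CoPH cutGrid selGapDepth₁₃ crGap₁₃VAt crGap₁₃V shellWeightBound_crGap₁₃VAt' keyedShellWeight_shape_crGap₁₃V_of_rows')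
open Summit.QuantumFields.YangMills.Theorems.N21GappedTopCutDials (exists_widthDepthLetters_of_summable)
open Summit.QuantumFields.YangMills.Theorems.N21TwoRunDevice (collar_rows_at_selGapDepth_A collar_rows_at_selGapDepth_B)

variable {N : ℕ} [NeZero N]

/-- ★★★ **N21's SHELL FACE AT THE GAPPED READING WITH DIALS PRODUCED FROM ONE CLOSENESS LETTER.**  For a relative two-run closeness letter `δ` with `0 ≤ δ_K ≤ 1/16` and `Σ_K δ_K < ∞`
at every tuple: there are letters `ρ, n` such that (i) at every tuple on the live-selector line under (H-ζ), `T4IndicatorShell.ShellWeightBound` holds at dag-n21-d's gapped reading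
`crGap₁₃VAt N K₀ jcut ρ n` (U8b `shellWeightBound_crGap₁₃VAt'`, (M1)-free, sign-free) and (ii) the consumer's compatibility rows `0 ≤ ρ ≤ 1`, `Σ 1/(n+1) < ∞`, `2δ ≤ ρ`,
`(1−ρ)^{n+2} ≥ 1/2`, `δ ≤ (1−ρ)^i ρ` (`i ≤ n+2`) hold at every tuple. [bookkeeping] -/
theorem exists_letters_shellWeightBound_crGap₁₃VAt_of_closeness (K₀ : ℕ) (jcut : ℕ → ℕ) (δ : WidthLetter₁₃CoPH N)
    (h0 : ∀ (F : T4Family) (θ : Stage13HParams F N) (hP : θ.Provisos₁₃CoPH F N) (g₀ : ℕ → ℝ) (os : List (ULoop F)) (K : ℕ), 0 ≤ δ F θ hP g₀ os K)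
    (h16 : ∀ (F : T4Family) (θ : Stage13HParams F N) (hP : θ.Provisos₁₃CoPH F N) (g₀ : ℕ → ℝ) (os : List (ULoop F)) (K : ℕ), δ F θ hP g₀ os K ≤ 1 / 16)
    (hs : ∀ (F : T4Family) (θ : Stage13HParams F N) (hP : θ.Provisos₁₃CoPH F N) (g₀ : ℕ → ℝ) (os : List (ULoop F)), Summable (δ F θ hP g₀ os)) :
    ∃ (ρ : WidthLetter₁₃CoPH N) (n : DepthLetter₁₃CoPH N),
      (∀ (F : T4Family) (θ : Stage13HParams F N) (hP : θ.Provisos₁₃CoPH F N) (g₀ : ℕ → ℝ) (os : List (ULoop F)) (E : B12.RunParams → ℝ),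
        θ.ppSel = ppSelLiveOfRecord F N θ.ν θ.τ9 E (wOfRecord₉ F N θ.toStage9Params) → ZetaMeasurable F N θ.ζ →
        ShellWeightBound (crGap₁₃VAt N K₀ jcut ρ n F θ hP g₀ os).l₀ (crGap₁₃VAt N K₀ jcut ρ n F θ hP g₀ os).T (crGap₁₃VAt N K₀ jcut ρ n F θ hP g₀ os).A
          (crGap₁₃VAt N K₀ jcut ρ n F θ hP g₀ os).B (crGap₁₃VAt N K₀ jcut ρ n F θ hP g₀ os).shA (crGap₁₃VAt N K₀ jcut ρ n F θ hP g₀ os).shB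
          (crGap₁₃VAt N K₀ jcut ρ n F θ hP g₀ os).Wsh) ∧
      (∀ (F : T4Family) (θ : Stage13HParams F N) (hP : θ.Provisos₁₃CoPH F N) (g₀ : ℕ → ℝ) (os : List (ULoop F)),
        (∀ K, 0 ≤ ρ F θ hP g₀ os K) ∧ (∀ K, ρ F θ hP g₀ os K ≤ 1) ∧ Summable (fun K => 1 / ((n F θ hP g₀ os K : ℝ) + 1)) ∧
        (∀ K, 2 * δ F θ hP g₀ os K ≤ ρ F θ hP g₀ os K) ∧ (∀ K, (1 : ℝ) / 2 ≤ (1 - ρ F θ hP g₀ os K) ^ (n F θ hP g₀ os K + 2)) ∧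
        (∀ K i, i ≤ n F θ hP g₀ os K + 2 → δ F θ hP g₀ os K ≤ (1 - ρ F θ hP g₀ os K) ^ i * ρ F θ hP g₀ os K)) := by
  obtain ⟨ρ, n, h⟩ := exists_widthDepthLetters_of_summable δ h0 h16 hs
  refine ⟨ρ, n, fun F θ hP g₀ os E hsel hζm => ?_, h⟩
  obtain ⟨hρ0, hρ1, hn, -, -, -⟩ := h F θ hP g₀ os
  exact shellWeightBound_crGap₁₃VAt' K₀ jcut ρ n θ hP g₀ os E hsel hζm hρ0 hρ1 hn

/-- ★★ **THE K3 STUB-2 CONJUNCT's ∀-SHAPE AT `crGap₁₃V` WITH THE DIAL ROWS DISCHARGED** (U8b `keyedShellWeight_shape_crGap₁₃V_of_rows'` + file 2): from the closeness letter there are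
letters `ρ, n` such that the skeleton-shaped `KeyedShellWeight` face at `crGap₁₃V N jcut ρ n` holds modulo the live-selector pin and (H-ζ) ONLY, ∧ the compatibility rows. [bookkeeping] -/
theorem exists_letters_keyedShellWeight_shape_crGap₁₃V_of_closeness (jcut : ℕ → ℕ) (δ : WidthLetter₁₃CoPH N) (E : (F : T4Family) → Stage13HParams F N → (B12.RunParams → ℝ))
    (h0 : ∀ (F : T4Family) (θ : Stage13HParams F N) (hP : θ.Provisos₁₃CoPH F N) (g₀ : ℕ → ℝ) (os : List (ULoop F)) (K : ℕ), 0 ≤ δ F θ hP g₀ os K)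
    (h16 : ∀ (F : T4Family) (θ : Stage13HParams F N) (hP : θ.Provisos₁₃CoPH F N) (g₀ : ℕ → ℝ) (os : List (ULoop F)) (K : ℕ), δ F θ hP g₀ os K ≤ 1 / 16)
    (hs : ∀ (F : T4Family) (θ : Stage13HParams F N) (hP : θ.Provisos₁₃CoPH F N) (g₀ : ℕ → ℝ) (os : List (ULoop F)), Summable (δ F θ hP g₀ os)) :
    ∃ (ρ : WidthLetter₁₃CoPH N) (n : DepthLetter₁₃CoPH N),
      (∀ (F : T4Family) (θ : Stage13HParams F N) (hP : θ.Provisos₁₃CoPH F N),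
        θ.ppSel = ppSelLiveOfRecord F N θ.ν θ.τ9 (E F θ) (wOfRecord₉ F N θ.toStage9Params) → ZetaMeasurable F N θ.ζ →
        ∀ (g₀ : ℕ → ℝ) (os : List (ULoop F)),
          ShellWeightBound (crGap₁₃V N jcut ρ n F θ hP g₀ os).l₀ (crGap₁₃V N jcut ρ n F θ hP g₀ os).T (crGap₁₃V N jcut ρ n F θ hP g₀ os).A
            (crGap₁₃V N jcut ρ n F θ hP g₀ os).B (crGap₁₃V N jcut ρ n F θ hP g₀ os).shA (crGap₁₃V N jcut ρ n F θ hP g₀ os).shB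
            (crGap₁₃V N jcut ρ n F θ hP g₀ os).Wsh) ∧
      (∀ (F : T4Family) (θ : Stage13HParams F N) (hP : θ.Provisos₁₃CoPH F N) (g₀ : ℕ → ℝ) (os : List (ULoop F)),
        (∀ K, 0 ≤ ρ F θ hP g₀ os K) ∧ (∀ K, ρ F θ hP g₀ os K ≤ 1) ∧ Summable (fun K => 1 / ((n F θ hP g₀ os K : ℝ) + 1)) ∧
        (∀ K, 2 * δ F θ hP g₀ os K ≤ ρ F θ hP g₀ os K) ∧ (∀ K, (1 : ℝ) / 2 ≤ (1 - ρ F θ hP g₀ os K) ^ (n F θ hP g₀ os K + 2)) ∧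
        (∀ K i, i ≤ n F θ hP g₀ os K + 2 → δ F θ hP g₀ os K ≤ (1 - ρ F θ hP g₀ os K) ^ i * ρ F θ hP g₀ os K)) := by
  obtain ⟨ρ, n, h⟩ := exists_widthDepthLetters_of_summable δ h0 h16 hs
  refine ⟨ρ, n, fun F θ hP hsel hζm g₀ os => ?_, h⟩
  obtain ⟨hρ0, hρ1, hn, -, -, -⟩ := h F θ hP g₀ os
  exact keyedShellWeight_shape_crGap₁₃V_of_rows' jcut ρ n E F θ hP hsel hζm g₀ os hρ0 hρ1 hn

/-- ★ **THE COMPATIBILITY ROWS AT ONE `(tuple, K)` GIVE THE SELECTED-DEPTH COLLAR ROWS FOR BOTH RUNS** (file 3 §4, re-exported on this import line): with `0 ≤ ε` at the two top levels,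
the letters of `gapShellA₁₃` (top `K₀ + K`, `histA₁₃`) and `gapShellB₁₃` (top `K₀ + K + 1`, `histB₁₃`) at `i⋆ = selGapDepth₁₃ …` clear `ε·δ` on both sides and lie in `[ε/2, ε]`. [bookkeeping] -/
theorem collar_rows_at_selGapDepth_of_compat {F : T4Family} (θ : Stage13HParams F N) (hP : θ.Provisos₁₃CoPH F N) (K₀ : ℕ) (g₀ : ℕ → ℝ) (os : List (ULoop F))
    (ρ : ℕ → ℝ) (n : ℕ → ℕ) (K : ℕ) (t : ℝ) {δ : ℝ} (hρ0 : 0 ≤ ρ K) (hρ1 : ρ K ≤ 1) (hhalf : (1 : ℝ) / 2 ≤ (1 - ρ K) ^ (n K + 2))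
    (hcompat : ∀ j, j ≤ n K + 2 → δ ≤ (1 - ρ K) ^ j * ρ K)
    (hεA : 0 ≤ epsOfRecord θ.ν (histA₁₃ θ K₀ g₀ K) (K₀ + K)) (hεB : 0 ≤ epsOfRecord θ.ν (histB₁₃ θ K₀ g₀ K) (K₀ + K + 1)) :
    (cutGrid θ.ν (histA₁₃ θ K₀ g₀ K) (K₀ + K) (ρ K) (selGapDepth₁₃ θ hP K₀ g₀ os ρ (n K) K t + 2) + epsOfRecord θ.ν (histA₁₃ θ K₀ g₀ K) (K₀ + K) * δ ≤
        cutGrid θ.ν (histA₁₃ θ K₀ g₀ K) (K₀ + K) (ρ K) (selGapDepth₁₃ θ hP K₀ g₀ os ρ (n K) K t + 1) ∧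
      cutGrid θ.ν (histA₁₃ θ K₀ g₀ K) (K₀ + K) (ρ K) (selGapDepth₁₃ θ hP K₀ g₀ os ρ (n K) K t + 1) + epsOfRecord θ.ν (histA₁₃ θ K₀ g₀ K) (K₀ + K) * δ ≤
        cutGrid θ.ν (histA₁₃ θ K₀ g₀ K) (K₀ + K) (ρ K) (selGapDepth₁₃ θ hP K₀ g₀ os ρ (n K) K t) ∧
      epsOfRecord θ.ν (histA₁₃ θ K₀ g₀ K) (K₀ + K) / 2 ≤ cutGrid θ.ν (histA₁₃ θ K₀ g₀ K) (K₀ + K) (ρ K) (selGapDepth₁₃ θ hP K₀ g₀ os ρ (n K) K t + 2) ∧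
      cutGrid θ.ν (histA₁₃ θ K₀ g₀ K) (K₀ + K) (ρ K) (selGapDepth₁₃ θ hP K₀ g₀ os ρ (n K) K t) ≤ epsOfRecord θ.ν (histA₁₃ θ K₀ g₀ K) (K₀ + K)) ∧
    (cutGrid θ.ν (histB₁₃ θ K₀ g₀ K) (K₀ + K + 1) (ρ K) (selGapDepth₁₃ θ hP K₀ g₀ os ρ (n K) K t + 2) + epsOfRecord θ.ν (histB₁₃ θ K₀ g₀ K) (K₀ + K + 1) * δ ≤
        cutGrid θ.ν (histB₁₃ θ K₀ g₀ K) (K₀ + K + 1) (ρ K) (selGapDepth₁₃ θ hP K₀ g₀ os ρ (n K) K t + 1) ∧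
      cutGrid θ.ν (histB₁₃ θ K₀ g₀ K) (K₀ + K + 1) (ρ K) (selGapDepth₁₃ θ hP K₀ g₀ os ρ (n K) K t + 1) + epsOfRecord θ.ν (histB₁₃ θ K₀ g₀ K) (K₀ + K + 1) * δ ≤
        cutGrid θ.ν (histB₁₃ θ K₀ g₀ K) (K₀ + K + 1) (ρ K) (selGapDepth₁₃ θ hP K₀ g₀ os ρ (n K) K t) ∧
      epsOfRecord θ.ν (histB₁₃ θ K₀ g₀ K) (K₀ + K + 1) / 2 ≤ cutGrid θ.ν (histB₁₃ θ K₀ g₀ K) (K₀ + K + 1) (ρ K) (selGapDepth₁₃ θ hP K₀ g₀ os ρ (n K) K t + 2) ∧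
      cutGrid θ.ν (histB₁₃ θ K₀ g₀ K) (K₀ + K + 1) (ρ K) (selGapDepth₁₃ θ hP K₀ g₀ os ρ (n K) K t) ≤ epsOfRecord θ.ν (histB₁₃ θ K₀ g₀ K) (K₀ + K + 1)) :=
  ⟨collar_rows_at_selGapDepth_A θ hP K₀ g₀ os ρ n K t hεA hρ0 hρ1 hhalf hcompat, collar_rows_at_selGapDepth_B θ hP K₀ g₀ os ρ n K t hεB hρ0 hρ1 hhalf hcompat⟩

end Summit.QuantumFields.YangMills.Theorems.N21GappedReadingShellFaceOfCloseness
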